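import Summits.BirchSwinnertonDyer.BirchSwinnertonDyer.Theorems.PrintCf2RubinValueTwoTwoVariableLayerRigidity
import Mathlib.Algebra.CharP.Lemmas
import Mathlib.Algebra.CharP.Algebra
import HarnessLib

/-!
# Layer rigidity, the CYCLOTOMIC LAYER FAMILIES: `ω_n = (1+T)^{pⁿ} − 1` and `Φ_{p^{n+1}}(1+T) = Σ_{i<p} (1+T)^{i pⁿ}` reduce mod `p` to powers of `T`,
# so both are «layer families» for `LayerRigidity.span_singleton_eq_of_dvd_of_layers`

Cell `bsd-print-cf2`, width seat `bsd-line-cf2c-w8` g6 (prover-bsd-line-cf2c-w8-g6-0); memo `Cruxes/MainConjClauseAtSplitTwoQuad/A-BRICK-PRINT-MAP-cf2c-w8g6.md` §5.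
The rigidity theorem (p715747) is stated for any `φ : ℕ → ℤ_p⟦T⟧` with `φ_n ≢ 0 (mod p)` and `T^N ∣ φ_n (mod p)` for `n ≫ 0`; here the two families a
consumer meets: the LEVEL relations `ω_n(T) = (1+T)^{pⁿ} − 1` (all characters of `Γ/Γ^{pⁿ}` at once; `≡ T^{pⁿ}`) and the PRIMITIVE-LEVEL relations
`Φ_{p^{n+1}}(1+T) = ω_{n+1}/ω_n = Σ_{i<p} (1+T)^{i pⁿ}` (the characters of exact order `p^{n+1}`; quotient `ℤ_p[ζ_{p^{n+1}}]⟦·⟧`; `≡ T^{pⁿ(p−1)}`), written as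
explicit power series (no definition introduced): `map_toZMod_omega`, `map_toZMod_cyclotomicLayer`, and the two layer-family certificates
`layerFamily_omega`, `layerFamily_cyclotomic` (conjunctions `hφ₁ ∧ hφ₂` in the binders of p715747). Pure algebra (Frobenius `(1+T)^{pⁿ} = 1 + T^{pⁿ}` in
`𝔽_p⟦T⟧`); THEOREMS ONLY; Mathlib-only beyond part I. No summit statement is proved; BSD is not proved by any of this. beyond-print theorem: no.

References: [Washington1997] §7.1–7.2 (`ω_n`, distinguished polynomials), §13.2.
-/

set_option autoImplicit false
-- the summit namespace `Summit.BirchSwinnertonDyer.BirchSwinnertonDyer` repeats the problem name by design (D-0017)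
set_option linter.dupNamespace false

open PowerSeries Finset

namespace Summit.BirchSwinnertonDyer.BirchSwinnertonDyer.Theorems.PrintCf2.LayerRigidity

variable {p : ℕ} [Fact p.Prime]

/-- Frobenius in `𝔽_p⟦T⟧`: `(1+T)^{pⁿ} = 1 + T^{pⁿ}`. [folklore] -/
theorem one_add_X_pow_prime_pow (n : ℕ) : ((1 : PowerSeries (ZMod p)) + X) ^ p ^ n = 1 + X ^ p ^ n := by
  haveI : CharP (PowerSeries (ZMod p)) p := charP_of_injective_algebraMap (C_injective (R := ZMod p)) p
  rw [add_pow_char_pow, one_pow]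

/-- `ω_n(T) = (1+T)^{pⁿ} − 1 ≡ T^{pⁿ} (mod p)`. [cite: Washington1997, §7.1] -/
theorem map_toZMod_omega (n : ℕ) :
    PowerSeries.map (PadicInt.toZMod (p := p)) (((1 : PowerSeries ℤ_[p]) + X) ^ p ^ n - 1) = X ^ p ^ n := by
  rw [map_sub, map_pow, map_add, map_one, map_X, one_add_X_pow_prime_pow, add_sub_cancel_left]

/-- `Φ_{p^{n+1}}(1+T) = Σ_{i<p} (1+T)^{i pⁿ} ≡ T^{pⁿ(p−1)} (mod p)` (`u·Σ_{i<p}(1+u)^i = (1+u)^p − 1 = u^p` with `u = T^{pⁿ}`, cancel `u` in the domain `𝔽_p⟦T⟧`).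
[cite: Washington1997, §7.1–7.2] -/
theorem map_toZMod_cyclotomicLayer (n : ℕ) :
    PowerSeries.map (PadicInt.toZMod (p := p)) (∑ i ∈ range p, ((1 : PowerSeries ℤ_[p]) + X) ^ (i * p ^ n)) = X ^ (p ^ n * (p - 1)) := by
  have hp : p.Prime := Fact.out
  haveI : CharP (PowerSeries (ZMod p)) p := charP_of_injective_algebraMap (C_injective (R := ZMod p)) p
  set u : PowerSeries (ZMod p) := X ^ p ^ n with hu
  have hu0 : u ≠ 0 := pow_ne_zero _ X_ne_zero
  -- each summand reduces to `(1+u)^i`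
  have hterm : ∀ i : ℕ, PowerSeries.map (PadicInt.toZMod (p := p)) (((1 : PowerSeries ℤ_[p]) + X) ^ (i * p ^ n)) = (1 + u) ^ i := by
    intro i
    rw [map_pow, map_add, map_one, map_X, pow_mul', one_add_X_pow_prime_pow]
  rw [map_sum, Finset.sum_congr rfl fun i _ ↦ hterm i]
  -- `u · Σ_{i<p} (1+u)^i = (1+u)^p − 1 = u^p`
  have hgeom : u * ∑ i ∈ range p, (1 + u) ^ i = u ^ p := by
    have h := geom_sum_mul (1 + u) p
    rw [add_sub_cancel_left] at h
    rw [mul_comm, h, add_pow_char, one_pow, add_sub_cancel_left]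
  have hsum : ∑ i ∈ range p, (1 + u) ^ i = u ^ (p - 1) := by
    apply mul_left_cancel₀ hu0
    rw [hgeom, ← pow_succ', Nat.sub_add_cancel hp.one_le]
  rw [hsum, hu, ← pow_mul]

/-- **`(ω_n)_n` is a layer family**: `ω_n ≢ 0` and `T^N ∣ ω_n (mod p)` for `pⁿ ≥ N`. [cite: Washington1997, §7.1] -/
theorem layerFamily_omega :
    (∀ n : ℕ, PowerSeries.map (PadicInt.toZMod (p := p)) (((1 : PowerSeries ℤ_[p]) + X) ^ p ^ n - 1) ≠ 0) ∧
    (∀ N : ℕ, ∃ n : ℕ, (X : PowerSeries (ZMod p)) ^ N ∣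
      PowerSeries.map (PadicInt.toZMod (p := p)) (((1 : PowerSeries ℤ_[p]) + X) ^ p ^ n - 1)) := by
  have hp : p.Prime := Fact.out
  refine ⟨fun n ↦ by rw [map_toZMod_omega]; exact pow_ne_zero _ X_ne_zero, fun N ↦ ⟨N, ?_⟩⟩
  rw [map_toZMod_omega]
  exact pow_dvd_pow X (Nat.lt_pow_self hp.one_lt).le

/-- **`(Φ_{p^{n+1}}(1+T))_n` is a layer family**: `≢ 0` and `T^N ∣ Φ_{p^{n+1}}(1+T) (mod p)` for `pⁿ(p−1) ≥ N`. [cite: Washington1997, §7.2] -/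
theorem layerFamily_cyclotomic :
    (∀ n : ℕ, PowerSeries.map (PadicInt.toZMod (p := p)) (∑ i ∈ range p, ((1 : PowerSeries ℤ_[p]) + X) ^ (i * p ^ n)) ≠ 0) ∧
    (∀ N : ℕ, ∃ n : ℕ, (X : PowerSeries (ZMod p)) ^ N ∣
      PowerSeries.map (PadicInt.toZMod (p := p)) (∑ i ∈ range p, ((1 : PowerSeries ℤ_[p]) + X) ^ (i * p ^ n))) := by
  have hp : p.Prime := Fact.out
  refine ⟨fun n ↦ by rw [map_toZMod_cyclotomicLayer]; exact pow_ne_zero _ X_ne_zero, fun N ↦ ⟨N, ?_⟩⟩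
  rw [map_toZMod_cyclotomicLayer]
  refine pow_dvd_pow X (le_trans (Nat.lt_pow_self hp.one_lt).le ?_)
  exact Nat.le_mul_of_pos_right _ (Nat.sub_pos_of_lt hp.one_lt)

/-- **Layer rigidity along the primitive cyclotomic layers** (p715747 with `φ_n = Φ_{p^{n+1}}(1+T₂)`): `A·h = p^k·B` in `Λ₂` and `(Ā) = (B̄)`, `Ā` a
non-zero-divisor, on every layer `Λ₂/(Φ_{p^{n+1}}(1+T₂))` ⟹ `(A) = (B)`. [cite: Washington1997, §13.2] -/
theorem span_singleton_eq_of_dvd_of_cyclotomicLayers {A B h : PowerSeries (PowerSeries ℤ_[p])} {k : ℕ}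
    (hAB : A * h = C (C ((p : ℤ_[p]) ^ k)) * B)
    (hline : ∀ n : ℕ,
      Ideal.span {Ideal.Quotient.mk (Ideal.span {C (∑ i ∈ range p, ((1 : PowerSeries ℤ_[p]) + X) ^ (i * p ^ n))}) A} =
        Ideal.span {Ideal.Quotient.mk (Ideal.span {C (∑ i ∈ range p, ((1 : PowerSeries ℤ_[p]) + X) ^ (i * p ^ n))}) B} ∧
      ∀ x, A * x ∈ Ideal.span {C (∑ i ∈ range p, ((1 : PowerSeries ℤ_[p]) + X) ^ (i * p ^ n))} →
        x ∈ Ideal.span {C (∑ i ∈ range p, ((1 : PowerSeries ℤ_[p]) + X) ^ (i * p ^ n))}) :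
    Ideal.span {A} = Ideal.span {B} :=
  span_singleton_eq_of_dvd_of_layers_of_span_eq (fun n ↦ ∑ i ∈ range p, ((1 : PowerSeries ℤ_[p]) + X) ^ (i * p ^ n))
    layerFamily_cyclotomic.1 layerFamily_cyclotomic.2 hAB hline

end Summit.BirchSwinnertonDyer.BirchSwinnertonDyer.Theorems.PrintCf2.LayerRigidity
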